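import Summits.PneNP.PneNP.Theorems.CircuitNpTc0.Negative.SizeBoundLoadBearing
import Summits.PneNP.PneNP.Theorems.CircuitNpTc0.Negative.HoldsBelowMajority
import Summits.QuantumAdvantage.QuantumAdvantage.Theorems.MobiusLadderLiouvilleOrthogonalTC0StubDepthOneLtf
import Literature.Computability.Complexity.CircuitClassesProofs

/-!
# `CircuitNpTc0` (stmt-PneNP-0039, route `Circuit`): the no-size-bound collapse is tight at depth 2

Negative knowledge for the crux `Summit.PneNP.PneNP.Theses.Circuit.CircuitNpTc0 = ¬ (NP ⊆ TC0)`
(refuter, cdisprove cycle 1; asserts no Theses declaration). `SizeBoundLoadBearing.lean` shows that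
with the polynomial size bound dropped the crux fails already at `acDepth 2`. This file shows that
depth `2` is exactly where it fails: at `acDepth ≤ 1` a circuit over `tcBasis` — of ANY size — is an
integer linear threshold function of its inputs (the tree's
`Summit.QuantumAdvantage.QuantumAdvantage.Theorems.LiouvilleOrthogonalTC0.stub_depthOne_ltf`), and
`XOR₂` is not one (`parity_two_not_ltf`), so `PARITY ∉ DepthSizeClass tcBasis 1 s` for every size
bound `s` (`PARITY_not_mem_depthOne`) and the depth-`≤ 1`, any-size form of the crux HOLDS
(`NP_not_subset_depthOne_anySize`); altogether every language has depth-`d` `tcBasis` circuits of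
some size iff `2 ≤ d` (`forall_exists_mem_depthSizeClass_iff`).

Frontier remark (prose): `Circuit.size` counts gates, gate arguments may repeat and `¬` is depth-free,
so depth-`d` polynomial-size `TC⁰` in this formalisation is `LT_d` with unrestricted weights; the
depth-`2` case of the crux is therefore already the open `THR∘THR` gate lower-bound problem
(record `n^{1.5-o(1)}` gates, Kane–Williams 2016, arXiv:1511.07860), while depth `≤ 1` is settled here.
-/

-- `Summit.<Summit>.<Problem>`: for the single-conjunct summit `PneNP` the duplicate `PneNP.PneNP` is mandated.
set_option linter.dupNamespace false

namespace Summit.PneNP.PneNP.Theorems.CircuitNpTc0.Negative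

open Literature.Computability.Complexity
open Summit.QuantumAdvantage.QuantumAdvantage.Theorems.LiouvilleOrthogonalTC0 (stub_depthOne_ltf)

/-- **`XOR₂` is not a linear threshold function** (the four points `00, 10, 01, 11` force
`0 < θ ≤ w₀`, `θ ≤ w₁`, `w₀ + w₁ < θ`). [folklore] -/
theorem parity_two_not_ltf (w : Fin 2 → ℤ) (θ : ℤ) :
    ¬ ∀ x : Fin 2 → Bool, parityFn 2 x = decide (θ ≤ ∑ i, w i * (if x i then (1 : ℤ) else 0)) := by
  intro h
  have e00 : parityFn 2 ![false, false] = false := by decide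
  have e10 : parityFn 2 ![true, false] = true := by decide
  have e01 : parityFn 2 ![false, true] = true := by decide
  have e11 : parityFn 2 ![true, true] = false := by decide
  have h00 := (h ![false, false]).symm.trans e00
  have h10 := (h ![true, false]).symm.trans e10
  have h01 := (h ![false, true]).symm.trans e01
  have h11 := (h ![true, true]).symm.trans e11
  simp only [Fin.sum_univ_two, Matrix.cons_val_zero, Matrix.cons_val_one, decide_eq_true_eq,
    decide_eq_false_iff_not] at h00 h10 h01 h11
  simp at h00 h10 h01 h11
  omega

/-- **`PARITY` has no `acDepth ≤ 1` threshold circuits of any size.** [folklore] -/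
theorem PARITY_not_mem_depthOne (s : ℕ → ℕ) : PARITY ∉ DepthSizeClass tcBasis (fun _ => 1) s := by
  rintro ⟨C, hC, hdec⟩
  obtain ⟨w, θ, hw⟩ := stub_depthOne_ltf (C 2) (hC 2).1 (hC 2).2.1
  refine parity_two_not_ltf w θ fun x => ?_
  rw [← hw x, hdec.eval_eq x]
  exact (Literature.Barriers.PneNP.ParityUpper.PARITY_sliceFn 2 x).symm

/-- Hence also at `acDepth 0` (monotonicity). [folklore] -/
theorem PARITY_not_mem_depthZero (s : ℕ → ℕ) : PARITY ∉ DepthSizeClass tcBasis (fun _ => 0) s :=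
  fun h => PARITY_not_mem_depthOne s
    (DepthSizeClass_mono le_rfl (fun _ => Nat.zero_le 1) (fun _ => le_rfl) h)

/-- **The depth-`≤ 1` form of the crux holds for every size bound**: `NP ⊄ DepthSizeClass tcBasis 1 s`.
[folklore] -/
theorem NP_not_subset_depthOne (s : ℕ → ℕ) :
    ¬ (Nondeterministic.NP ⊆ DepthSizeClass tcBasis (fun _ => 1) s) := fun h =>
  PARITY_not_mem_depthOne s (h PARITY_mem_NP)

/-- **Tightness of `circuitNpTc0_false_without_sizeBound`**: with the size bound dropped the crux
fails at depth `2` (`SizeBoundLoadBearing.lean`) but HOLDS at depth `≤ 1` — `NP` is not inside the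
depth-1 threshold circuits of unrestricted size. [folklore] -/
theorem NP_not_subset_depthOne_anySize :
    ¬ (Nondeterministic.NP ⊆ {L | ∃ s : ℕ → ℕ, L ∈ DepthSizeClass tcBasis (fun _ => 1) s}) := by
  intro h
  obtain ⟨s, hs⟩ := h PARITY_mem_NP
  exact PARITY_not_mem_depthOne s hs

/-- **The no-size-bound collapse depth over `tcBasis` is exactly `2`**: every language has depth-`d`
threshold circuits of some size iff `2 ≤ d` (`mem_depthSizeClass_two_exp` / `PARITY_not_mem_depthOne`).
[folklore] -/
theorem forall_exists_mem_depthSizeClass_iff (d : ℕ) :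
    (∀ L : Language Bool, ∃ s : ℕ → ℕ, L ∈ DepthSizeClass tcBasis (fun _ => d) s) ↔ 2 ≤ d := by
  constructor
  · intro h
    by_contra hd
    obtain ⟨s, hs⟩ := h PARITY
    exact PARITY_not_mem_depthOne s
      (DepthSizeClass_mono le_rfl (fun _ => (by omega : d ≤ 1)) (fun _ => le_rfl) hs)
  · intro hd L
    exact ⟨_, DepthSizeClass_mono le_rfl (fun _ => hd) (fun _ => le_rfl) (mem_depthSizeClass_two_exp L)⟩

end Summit.PneNP.PneNP.Theorems.CircuitNpTc0.Negative
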